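import Literature.AlgebraicTopology.SingularHomology.StdSimplexFaces
import Mathlib.Topology.UnitInterval
import Mathlib.Topology.Order.Lattice
import HarnessLib

/-!
# Pushing the prism `Δ^q × I` onto its top and sides; homotopies of pairs into homotopies
rel `∂Δ^q`

Topic `Literature/AlgebraicTopology/Homotopy`. The elementary geometric device behind the
equivalence of the two forms of the compression criterion for maps of pairs
`(Dⁿ, Sⁿ⁻¹) → (X, A)` (A. Hatcher, *Algebraic Topology* (2002), §4.1, p. 343: "the restriction of
`F` [a homotopy of pairs to a map into `A`] to `Dⁿ × {1} ∪ Sⁿ⁻¹ × I` … since `Dⁿ × I`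
deformation retracts onto `Dⁿ × {1} ∪ Sⁿ⁻¹ × I` … gives a homotopy rel `Sⁿ⁻¹`" into `A`;
E. H. Spanier, *Algebraic Topology* (1966), Ch. 7 §2, Thm. 1, with the explicit formula `H'`),
written for the standard simplex `Δ^q = StdSimplex q` of the tree's singular-homology files, where
it is used for the relative Hurewicz theorem (`RelativeCompression.lean`). Everything is PROVED
(`[folklore]`):

* `PrismTop.coordMin z = minᵢ zᵢ` and `PrismTop.dil z = β / max (β - minᵢ zᵢ) (β/2)`,
  `β = (q+1)⁻¹` the common coordinate of the barycentre `b`: the factor (between `1` and `2`) by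
  which the radial projection from the point `(b, -1)` below the prism stretches the bottom point
  `(z, 0)` before it hits the top `Δ^q × {1}` or a side `∂Δ^q × I`;
* `PrismTop.hat : C(I × Δ^q, Δ^q × I)`, `(s, z) ↦ (b + μ (z - b), μ - 1)` with
  `μ = 1 + s (dil z - 1)`: a homotopy of the bottom inclusion `z ↦ (z, 0)` (`hat_zero`) to a map
  into the top-and-sides `Δ^q × {1} ∪ ∂Δ^q × I` (`hat_one_mem`), stationary on `∂Δ^q`
  (`hat_of_mem_stdBoundary`) — the straight-line deformation onto Hatcher's retract, restricted
  to the bottom;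
* **`PrismTop.exists_homotopy_rel_of_pair_homotopy`**: if `L : Δ^q × I → X` is a homotopy of
  maps of pairs `(Δ^q, ∂Δ^q) → (X, A)` ending in a map into `A`, then `L(·, 0)` is homotopic
  *rel* `∂Δ^q` to a map into `A` (namely through `(z, s) ↦ L (hat (s, z))`).

## References

* A. Hatcher, *Algebraic Topology*, CUP (2002), §4.1, p. 343 (compression criterion);
  Prop. 0.16 (the retraction of `Dⁿ × I`). [HatcherAT2002]
* E. H. Spanier, *Algebraic Topology*, McGraw-Hill 1966 / Springer 1981, Ch. 7 §2, Thm. 1.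
  [Spanier1981]
-/

noncomputable section

open Set Function
open scoped unitInterval

namespace Literature.AlgebraicTopology.Homotopy

namespace PrismTop

open Literature.AlgebraicTopology.SingularHomology

variable {q : ℕ}

/-! ### The minimal coordinate and the dilation factor -/

variable (q) in
/-- `β = (q+1)⁻¹`, the common barycentric coordinate of the barycentre of `Δ^q`. [folklore] -/
def β : ℝ := ((q : ℝ) + 1)⁻¹

/-- `β > 0`. [folklore] -/
lemma β_pos : 0 < β q := by unfold β; positivity

/-- `(q + 1) β = 1`. [folklore] -/
lemma card_mul_β : ((q : ℝ) + 1) * β q = 1 := by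
  unfold β
  exact mul_inv_cancel₀ (by positivity)

/-- `minᵢ zᵢ`, the smallest barycentric coordinate of a point of `Δ^q`. [folklore] -/
def coordMin (z : StdSimplex q) : ℝ :=
  Finset.univ.inf' Finset.univ_nonempty fun i => z i

/-- `minᵢ zᵢ ≤ zⱼ`. [folklore] -/
lemma coordMin_le (z : StdSimplex q) (i : Fin (q + 1)) : coordMin z ≤ z i :=
  Finset.inf'_le _ (Finset.mem_univ i)

/-- `0 ≤ minᵢ zᵢ`. [folklore] -/
lemma coordMin_nonneg (z : StdSimplex q) : 0 ≤ coordMin z :=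
  Finset.le_inf' _ _ fun i _ => stdSimplex.zero_le z i

/-- The minimum is attained. [folklore] -/
lemma exists_apply_eq_coordMin (z : StdSimplex q) : ∃ i, z i = coordMin z := by
  obtain ⟨i, -, h⟩ := Finset.exists_mem_eq_inf' Finset.univ_nonempty (fun i => z i)
  exact ⟨i, h.symm⟩

/-- `minᵢ zᵢ = 0` exactly on the boundary `∂Δ^q`. [folklore] -/
lemma coordMin_eq_zero_iff (z : StdSimplex q) : coordMin z = 0 ↔ z ∈ stdBoundary q := by
  constructor
  · intro h
    obtain ⟨i, hi⟩ := exists_apply_eq_coordMin z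
    exact ⟨i, hi.trans h⟩
  · rintro ⟨i, hi⟩
    exact le_antisymm ((coordMin_le z i).trans_eq hi) (coordMin_nonneg z)

/-- `minᵢ zᵢ` is continuous. [folklore] -/
lemma continuous_coordMin : Continuous (coordMin (q := q)) :=
  Continuous.finset_inf'_apply Finset.univ_nonempty
    fun i _ => (continuous_apply i).comp continuous_subtype_val

/-- The denominator `max (β - minᵢ zᵢ) (β/2)` of the dilation factor. [folklore] -/
def den (z : StdSimplex q) : ℝ := max (β q - coordMin z) (β q / 2)

/-- `β/2 ≤ den z`. [folklore] -/
lemma half_β_le_den (z : StdSimplex q) : β q / 2 ≤ den z := le_max_right _ _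

/-- `den z > 0`. [folklore] -/
lemma den_pos (z : StdSimplex q) : 0 < den z :=
  lt_of_lt_of_le (half_pos β_pos) (half_β_le_den z)

/-- `den z ≤ β`. [folklore] -/
lemma den_le_β (z : StdSimplex q) : den z ≤ β q :=
  max_le (by linarith [coordMin_nonneg z]) (by linarith [β_pos (q := q)])

/-- `β - minᵢ zᵢ ≤ den z`. [folklore] -/
lemma sub_coordMin_le_den (z : StdSimplex q) : β q - coordMin z ≤ den z := le_max_left _ _

/-- `den` is continuous. [folklore] -/
lemma continuous_den : Continuous (den (q := q)) :=
  (continuous_const.sub continuous_coordMin).max continuous_const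

/-- **The dilation factor** `dil z = β / max (β - minᵢ zᵢ) (β/2) ∈ [1, 2]`: the parameter at
which the ray from `(b, -1)` through `(z, 0)` leaves the prism `Δ^q × [0, 1]` — through the side
`∂Δ^q × I` if `dil z < 2`, through the top if `dil z = 2`. [folklore] -/
def dil (z : StdSimplex q) : ℝ := β q / den z

/-- `1 ≤ dil z`. [folklore] -/
lemma one_le_dil (z : StdSimplex q) : 1 ≤ dil z := by
  rw [dil, le_div_iff₀ (den_pos z), one_mul]
  exact den_le_β z

/-- `dil z ≤ 2`. [folklore] -/
lemma dil_le_two (z : StdSimplex q) : dil z ≤ 2 := by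
  rw [dil, div_le_iff₀ (den_pos z)]
  linarith [half_β_le_den z]

/-- `dil z · den z = β`. [folklore] -/
lemma dil_mul_den (z : StdSimplex q) : dil z * den z = β q :=
  div_mul_cancel₀ _ (den_pos z).ne'

/-- `dil z · (β - minᵢ zᵢ) ≤ β`: the stretched point stays in the simplex. [folklore] -/
lemma dil_mul_sub_coordMin_le (z : StdSimplex q) : dil z * (β q - coordMin z) ≤ β q := by
  calc dil z * (β q - coordMin z) ≤ dil z * den z :=
        mul_le_mul_of_nonneg_left (sub_coordMin_le_den z) (by linarith [one_le_dil z])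
    _ = β q := dil_mul_den z

/-- On the boundary the dilation factor is `1`. [folklore] -/
lemma dil_of_mem_stdBoundary {z : StdSimplex q} (hz : z ∈ stdBoundary q) : dil z = 1 := by
  have h0 : coordMin z = 0 := (coordMin_eq_zero_iff z).2 hz
  have hd : den z = β q := by
    rw [den, h0, sub_zero]
    exact max_eq_left (by linarith [β_pos (q := q)])
  rw [dil, hd, div_self β_pos.ne']

/-- `dil` is continuous. [folklore] -/
lemma continuous_dil : Continuous (dil (q := q)) :=
  continuous_const.div continuous_den fun z => (den_pos z).ne'

/-! ### The deformation of the bottom onto the top and sides -/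

/-- The stretch parameter `μ = 1 + s (dil z - 1) ∈ [1, dil z]` at time `s`. [folklore] -/
def param (p : I × StdSimplex q) : ℝ := 1 + (p.1 : ℝ) * (dil p.2 - 1)

/-- `1 ≤ μ`. [folklore] -/
lemma one_le_param (p : I × StdSimplex q) : 1 ≤ param p := by
  unfold param
  nlinarith [unitInterval.nonneg p.1, one_le_dil p.2]

/-- `μ ≤ dil z`. [folklore] -/
lemma param_le_dil (p : I × StdSimplex q) : param p ≤ dil p.2 := by
  unfold param
  nlinarith [unitInterval.le_one p.1, one_le_dil p.2, unitInterval.nonneg p.1]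

/-- `μ ≤ 2`. [folklore] -/
lemma param_le_two (p : I × StdSimplex q) : param p ≤ 2 :=
  (param_le_dil p).trans (dil_le_two p.2)

/-- `μ` is continuous. [folklore] -/
lemma continuous_param : Continuous (param (q := q)) := by
  unfold param
  exact continuous_const.add ((continuous_subtype_val.comp continuous_fst).mul
    ((continuous_dil.comp continuous_snd).sub continuous_const))

/-- The coordinates `β + μ (zᵢ - β)` of the stretched point `b + μ (z - b)`. [folklore] -/
def hatFun (p : I × StdSimplex q) : Fin (q + 1) → ℝ := fun i => β q + param p * (p.2 i - β q)

/-- The stretched point lies in the simplex. [folklore] -/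
lemma hatFun_mem (p : I × StdSimplex q) : hatFun p ∈ stdSimplex ℝ (Fin (q + 1)) := by
  refine ⟨fun i => ?_, ?_⟩
  · -- `β + μ (zᵢ - β) ≥ β - dil z (β - min) ≥ 0`
    unfold hatFun
    by_cases hi : β q ≤ p.2 i
    · exact add_nonneg β_pos.le (mul_nonneg (by linarith [one_le_param p]) (by linarith))
    · rw [not_le] at hi
      have h1 : param p * (β q - p.2 i) ≤ dil p.2 * (β q - coordMin p.2) :=
        calc param p * (β q - p.2 i) ≤ dil p.2 * (β q - p.2 i) :=
              mul_le_mul_of_nonneg_right (param_le_dil p) (by linarith)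
          _ ≤ dil p.2 * (β q - coordMin p.2) :=
              mul_le_mul_of_nonneg_left (by linarith [coordMin_le p.2 i])
                (by linarith [one_le_dil p.2])
      linarith [dil_mul_sub_coordMin_le p.2]
  · unfold hatFun
    rw [Finset.sum_add_distrib, Finset.sum_const, Finset.card_univ, Fintype.card_fin,
      ← Finset.mul_sum, Finset.sum_sub_distrib, stdSimplex.sum_eq_one, Finset.sum_const,
      Finset.card_univ, Fintype.card_fin]
    simp only [nsmul_eq_mul]
    push_cast
    have h := card_mul_β (q := q)
    linear_combination (1 - param p) * h

/-- `hatFun` is continuous. [folklore] -/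
lemma continuous_hatFun : Continuous (hatFun (q := q)) :=
  continuous_pi fun i => continuous_const.add (continuous_param.mul
    ((((continuous_apply i).comp continuous_subtype_val).comp continuous_snd).sub
      continuous_const))

/-- The height `μ - 1 = s (dil z - 1) ∈ [0, 1]` of the stretched point. [folklore] -/
def hatHeight (p : I × StdSimplex q) : ℝ := (p.1 : ℝ) * (dil p.2 - 1)

/-- The height is `μ - 1`. [folklore] -/
lemma hatHeight_eq (p : I × StdSimplex q) : hatHeight p = param p - 1 := by
  unfold hatHeight param; ring

/-- The height lies in `[0, 1]`. [folklore] -/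
lemma hatHeight_mem (p : I × StdSimplex q) : hatHeight p ∈ I :=
  ⟨by rw [hatHeight_eq]; linarith [one_le_param p], by rw [hatHeight_eq]; linarith [param_le_two p]⟩

/-- The height is continuous. [folklore] -/
lemma continuous_hatHeight : Continuous (hatHeight (q := q)) :=
  (continuous_subtype_val.comp continuous_fst).mul
    ((continuous_dil.comp continuous_snd).sub continuous_const)

/-- **The deformation of the bottom of the prism onto its top and sides**:
`hat (s, z) = (b + μ (z - b), μ - 1)`, `μ = 1 + s (dil z - 1)` — at time `s`, the point at
parameter `μ` on the ray from `(b, -1)` through `(z, 0)` (Hatcher 2002, Prop. 0.16 / p. 343: the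
prism deformation retracts onto `Δ × {1} ∪ ∂Δ × I` along these rays; here only the restriction of
the straight-line deformation to the bottom `Δ × {0}` is needed). [folklore] -/
def hat : C(I × StdSimplex q, StdSimplex q × I) where
  toFun p := (⟨hatFun p, hatFun_mem p⟩, ⟨hatHeight p, hatHeight_mem p⟩)
  continuous_toFun := (continuous_hatFun.subtype_mk _).prodMk (continuous_hatHeight.subtype_mk _)

/-- Coordinates of the first component of `hat`. [folklore] -/
lemma hat_fst_apply (p : I × StdSimplex q) (i : Fin (q + 1)) :
    (hat p).1 i = β q + param p * (p.2 i - β q) := rfl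

/-- The height of `hat`. [folklore] -/
lemma hat_snd_coe (p : I × StdSimplex q) : ((hat p).2 : ℝ) = (p.1 : ℝ) * (dil p.2 - 1) := rfl

/-- **At time `0` the deformation is the bottom inclusion**: `hat (0, z) = (z, 0)`. [folklore] -/
@[simp]
theorem hat_zero (z : StdSimplex q) : hat (0, z) = (z, 0) := by
  have hp : param ((0 : I), z) = 1 := by simp [param]
  refine Prod.ext ?_ (Subtype.ext ?_)
  · ext i
    rw [hat_fst_apply, hp]
    ring
  · rw [hat_snd_coe]
    simp

/-- **The deformation is stationary on the boundary**: `hat (s, z) = (z, 0)` for `z ∈ ∂Δ^q`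
(there `dil z = 1`). [folklore] -/
theorem hat_of_mem_stdBoundary (s : I) {z : StdSimplex q} (hz : z ∈ stdBoundary q) :
    hat (s, z) = (z, 0) := by
  have hd : dil z = 1 := dil_of_mem_stdBoundary hz
  have hp : param (s, z) = 1 := by simp [param, hd]
  refine Prod.ext ?_ (Subtype.ext ?_)
  · ext i
    rw [hat_fst_apply, hp]
    ring
  · rw [hat_snd_coe, hd]
    simp

/-- **At time `1` the deformation lands in the top or the sides**: `hat (1, z)` has height `1`
or its first component lies on `∂Δ^q` (the ray through `(z, 0)` leaves the prism through the top
when `dil z = 2`, through the facet of the minimal coordinate otherwise). [folklore] -/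
theorem hat_one_mem (z : StdSimplex q) :
    (hat (1, z)).2 = 1 ∨ (hat (1, z)).1 ∈ stdBoundary q := by
  have hp : param ((1 : I), z) = dil z := by simp [param]
  by_cases h : den z = β q / 2
  · -- through the top: `dil z = 2`
    left
    have hd : dil z = 2 := by
      rw [dil, h, div_div_eq_mul_div, mul_div_right_comm, div_self β_pos.ne', one_mul]
    apply Subtype.ext
    rw [hat_snd_coe, hd]
    norm_num
  · -- through a side: `den z = β - min z`, and the minimal coordinate is stretched to `0`
    right
    have hden : den z = β q - coordMin z := by
      rcases max_choice (β q - coordMin z) (β q / 2) with h' | h'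
      · exact h'
      · exact absurd h' h
    obtain ⟨i, hi⟩ := exists_apply_eq_coordMin z
    refine ⟨i, ?_⟩
    show (hat (1, z)).1 i = 0
    rw [hat_fst_apply, hp]
    change β q + dil z * (z i - β q) = 0
    rw [hi]
    have h2 := dil_mul_den z
    rw [hden] at h2
    linarith

/-! ### Homotopies of pairs into homotopies rel `∂Δ^q` -/

variable {X : Type*} [TopologicalSpace X] {A : Set X}

/-- **A homotopy of pairs into `A` yields a homotopy rel `∂Δ^q` into `A`** (Hatcher 2002, p. 343,
compression criterion: "the restriction of `F` to `Dⁿ × {1} ∪ Sⁿ⁻¹ × I` … gives a homotopy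
rel `Sⁿ⁻¹`"; Spanier 1966, Thm. 7.2.1, the homotopy `H'`). If `L : Δ^q × I → X` satisfies
`L(∂Δ^q × I) ⊆ A` and `L(Δ^q × {1}) ⊆ A`, then `M (z, s) = L (hat (s, z))` is a homotopy from
`L(·, 0)` to a map into `A` which is stationary on `∂Δ^q`. [cite: HatcherAT2002, §4.1 p. 343] -/
theorem exists_homotopy_rel_of_pair_homotopy (L : C(StdSimplex q × I, X))
    (hside : ∀ z ∈ stdBoundary q, ∀ s : I, L (z, s) ∈ A) (htop : ∀ z, L (z, 1) ∈ A) :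
    ∃ M : C(StdSimplex q × I, X), (∀ z, M (z, 0) = L (z, 0)) ∧ (∀ z, M (z, 1) ∈ A) ∧
      ∀ z ∈ stdBoundary q, ∀ s : I, M (z, s) = L (z, 0) := by
  refine ⟨L.comp (hat.comp ContinuousMap.prodSwap), fun z => ?_, fun z => ?_, fun z hz s => ?_⟩
  · show L (hat (0, z)) = L (z, 0)
    rw [hat_zero]
  · show L (hat (1, z)) ∈ A
    rcases hat_one_mem z with h | h
    · have e : hat (1, z) = ((hat (1, z)).1, 1) := Prod.ext rfl h
      rw [e]
      exact htop _
    · have e : hat (1, z) = ((hat (1, z)).1, (hat (1, z)).2) := rfl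
      rw [e]
      exact hside _ h _
  · show L (hat (s, z)) = L (z, 0)
    rw [hat_of_mem_stdBoundary s hz]

end PrismTop

end Literature.AlgebraicTopology.Homotopy

end
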